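import Literature.NumberTheory.Rogawski1990.ArchCharactersRealCase       -- ★ (γ) p827732 `archRealCase_of_package` (+ ★ A8 `archRealReduction`, ★ A1, ★ A7, the letter texts)
import Literature.NumberTheory.Rogawski1990.ArchCharactersLinIndep       -- ★ p825905 the head text `ArchCharactersLinIndep`
import HarnessLib

/-!
# The archimedean factor of #85 FROM ITS LETTERS — `ArchCharactersLinIndep` modulo A5, A6, A7′ and the in-house (α), (β)

Topic `NumberTheory/Rogawski1990`; namespace `Literature.NumberTheory.Rogawski1990`; THEOREMS ONLY.  Cell `hodgecm-mathlib`, F0∕P3, crux H413, books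
row #85 (L2-SA) [Rogawski1990, Prop. 13.8.1 p. 212].  SIDECAR of typ-T1a's registered line `Cruxes/H413/Lines/F0_T1a_ArchCharactersLinIndep.lean`
(b8fa30127498; desk F0P3b-plan (g8) word 2026-08-31T15:56:59Z ∕ note 15:56:24Z): the PARAMETRISED head ★ `Rogawski1990.ArchCharactersLinIndep L ι H T hT νinf`
proved — in a BUILT Literature module, importable by both the T1a closer and T1b's `stub_archFactor` fold — from
* the three LETTERS of the line as hypotheses: `hTC` (A5, the text of ★ `ArchIntegratedOperatorTraceClass` at every frame [Knapp1986, Thm. 10.2]),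
  `hGE : HasUnitaryGlobalizationOfInfUnitary` (A6, [KnappVogan1995, Thm. 0.6 (a)]), `hIR : UnitaryGlobalizationIrreducible` (A7′, [KnappVogan1995, Thm. 0.4]);
* the two in-house sub-goals of `stub_archAssembly` as hypotheses: `hα` (A6a, six-clause bridge — A-p14 (g22)'s head type) and `hβ` (the BODY of the Lines text
  `ArchTestKcPackage` — LEAD F0P3b-p01 (g0)'s fold);
by the 12-line Re∕Im composition of the Lines file (:224–:249) run against PROVED theorems: ★ A8 `archRealReduction` (A-p01 (g17), p826869) and ★ (γ)
`archRealCase_of_package` (A-p06 (g23), p827732; itself over ★ A1 `weightedHilbertSchmidtVanishing_holds` p827101 and ★ A7 p826222).  The closer drops `hα hβ`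
by name: `archCharactersLinIndep_of_letters sixClauses_holds archTestKcPackage_holds hTC hGE hIR L ι H T hT νinf`.
HONEST LABEL: A5, A6, A7′ remain LETTERS; HC_CM is proved only modulo the printed citations until rung 0 closes.
-/

set_option autoImplicit false

noncomputable section

open NumberField MeasureTheory CompactlySupported Filter Topology
open scoped Matrix ComplexConjugate InnerProductSpace ENNReal NNReal

namespace Literature.NumberTheory.Rogawski1990

open Literature.NumberTheory.Automorphic Literature.NumberTheory.Automorphic.UnitaryGroup
open Literature.NumberTheory.Automorphic.UnitaryGroup.CotangentForms
open Literature.RepresentationTheory Literature.RepresentationTheory.KonnoKonno2007 Literature.RepresentationTheory.KonnoKonno2007.RealDualPair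
open NumberField.mixedEmbedding
-- `Classical` ∕ `ComplexOrder`: the scopes of the Lines texts (token-for-token binders).
open scoped Classical ComplexOrder

/-- **`ArchCharactersLinIndep` FROM ITS LETTERS** (the head of typ-T1a's arch line, parametrised form consumed BY NAME by T1b's `stub_archFactor`): for every CM frame
`(L, ι, H, T)` and Borel measure `νinf` on `G′_∞`, ★ `ArchCharactersLinIndep L ι H T hT νinf` follows from the six-clause bridge `hα`, the `ArchTestKc` package `hβ`, and
the three printed letters `hTC` (A5), `hGE` (A6), `hIR` (A7′).  Proof: split a complex coefficient family into real and imaginary parts (★ `archRealReduction`, both keep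
the support clause), kill each real family by ★ `archRealCase_of_package`, `Complex.ext`.
[cite: Rogawski1990, Prop. 13.8.1 p. 212] [cite: LabesseLanglands1979, Lemma 6.1 pp. 768–769] [cite: JacquetLanglands1970, §16, Lemma 16.1.1 (proof) p. 498] -/
theorem archCharactersLinIndep_of_letters
    (hα : ∀ r : GKIrrep (uFormGroup (Fin 2) (Fin 1)), IsAdmissibleGK r.ρK → r.IsInfUnitaryAlongP → Liu2021.LemD2.IsInfUnitary r.ρK r.ρ𝔤)
    (hβ : ∀ (L : Type) [Field L] [NumberField L] [IsCMField L] (ι : L →+* ℂ) (H : Matrix (Fin 3) (Fin 3) L) (T : GL (Fin 3) ℂ)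
      (hT : (T : Matrix (Fin 3) (Fin 3) ℂ)ᴴ * H.map ι * (T : Matrix (Fin 3) (Fin 3) ℂ) = Literature.Geometry.ComplexHyperbolic.BallModel.J)
      (νinf : @Measure (UnitaryGroup.arch (↥(maximalRealSubfield L)) L (IsCMField.complexConj L) 3 H) (borel _)),
      letI : MeasurableSpace (UnitaryGroup.arch (↥(maximalRealSubfield L)) L (IsCMField.complexConj L) 3 H) := borel _
      haveI : BorelSpace (UnitaryGroup.arch (↥(maximalRealSubfield L)) L (IsCMField.complexConj L) 3 H) := ⟨rfl⟩
      (∀ τ' : L →+* ℂ, InfinitePlace.mk τ' ≠ InfinitePlace.mk ι → (H.map τ').PosDef) →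
      ∀ (_hν : νinf.IsHaarMeasure),
        -- (a) `*`-algebra
        (∀ φ : UnitaryGroup.arch (↥(maximalRealSubfield L)) L (IsCMField.complexConj L) 3 H → ℂ, ArchTestKc L ι H T hT φ →
            ArchTestKc L ι H T hT (mulStar φ) ∧
            ∀ ψ : UnitaryGroup.arch (↥(maximalRealSubfield L)) L (IsCMField.complexConj L) 3 H → ℂ, ArchTestKc L ι H T hT ψ →
              ArchTestKc L ι H T hT (mulConv νinf φ ψ)) ∧
        -- (b) bi-`K_c`-average with the same operator on `K_c`-trivial representations
        (∀ ψ : UnitaryGroup.arch (↥(maximalRealSubfield L)) L (IsCMField.complexConj L) 3 H → ℂ, ∀ (hψc : Continuous ψ) (hψs : HasCompactSupport ψ),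
            (∃ ψ' : GL (Fin 3) (NumberField.mixedEmbedding.mixedSpace L) → ℂ, Continuous ψ' ∧ HasCompactSupport ψ' ∧
                IsArchSmooth (archGroupGL 3 L).carrier.subtype ψ' ∧
                ∀ k : UnitaryGroup.arch (↥(maximalRealSubfield L)) L (IsCMField.complexConj L) 3 H,
                  ψ k = ψ' (k : GL (Fin 3) (NumberField.mixedEmbedding.mixedSpace L))) →
            ∃ (ψn : UnitaryGroup.arch (↥(maximalRealSubfield L)) L (IsCMField.complexConj L) 3 H → ℂ) (hψn : ArchTestKc L ι H T hT ψn),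
              ∀ (x : GKIrrClass (uFormGroup (Fin 2) (Fin 1)))
                (E : Type) [NormedAddCommGroup E] [InnerProductSpace ℂ E] [CompleteSpace E]
                (ϖ : ContRepresentation ℂ (uFormGroup (Fin 2) (Fin 1)).carrier E) (hϖ : IsUnitaryGlobalization (uFormGroup (Fin 2) (Fin 1)) x ϖ),
                (ϖ.restrict (archProjUForm L ι H T hT)).integratedOperator (hϖ.isUnitary.restrict _)
                    (hϖ.isStronglyContinuous.restrict _ (continuous_archProjUForm L ι H T hT)) νinf ⟨⟨ψn, hψn.continuous⟩, hψn.hasCompactSupport⟩ =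
                  (ϖ.restrict (archProjUForm L ι H T hT)).integratedOperator (hϖ.isUnitary.restrict _)
                    (hϖ.isStronglyContinuous.restrict _ (continuous_archProjUForm L ι H T hT)) νinf ⟨⟨ψ, hψc⟩, hψs⟩) ∧
        -- (c) Dirac sequence in `ArchTestKc` for the `K_c`-trivial unitary globalizations
        (∃ (φn : ℕ → UnitaryGroup.arch (↥(maximalRealSubfield L)) L (IsCMField.complexConj L) 3 H → ℂ) (hφn : ∀ n, ArchTestKc L ι H T hT (φn n)),
            ∀ (x : GKIrrClass (uFormGroup (Fin 2) (Fin 1)))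
              (E : Type) [NormedAddCommGroup E] [InnerProductSpace ℂ E] [CompleteSpace E]
              (ϖ : ContRepresentation ℂ (uFormGroup (Fin 2) (Fin 1)).carrier E) (hϖ : IsUnitaryGlobalization (uFormGroup (Fin 2) (Fin 1)) x ϖ) (v : E),
              Tendsto (fun n => (ϖ.restrict (archProjUForm L ι H T hT)).integratedOperator (hϖ.isUnitary.restrict _)
                  (hϖ.isStronglyContinuous.restrict _ (continuous_archProjUForm L ι H T hT)) νinf
                  ⟨⟨φn n, (hφn n).continuous⟩, (hφn n).hasCompactSupport⟩ v) atTop (𝓝 v)))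
    (hTC : ∀ (L : Type) [Field L] [NumberField L] [IsCMField L] (ι : L →+* ℂ) (H : Matrix (Fin 3) (Fin 3) L) (T : GL (Fin 3) ℂ)
      (hT : (T : Matrix (Fin 3) (Fin 3) ℂ)ᴴ * H.map ι * (T : Matrix (Fin 3) (Fin 3) ℂ) = Literature.Geometry.ComplexHyperbolic.BallModel.J)
      (νinf : @Measure (UnitaryGroup.arch (↥(maximalRealSubfield L)) L (IsCMField.complexConj L) 3 H) (borel _)),
      ArchIntegratedOperatorTraceClass L ι H T hT νinf)
    (hGE : HasUnitaryGlobalizationOfInfUnitary) (hIR : UnitaryGlobalizationIrreducible)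
    (L : Type) [Field L] [NumberField L] [IsCMField L] (ι : L →+* ℂ) (H : Matrix (Fin 3) (Fin 3) L) (T : GL (Fin 3) ℂ)
    (hT : (T : Matrix (Fin 3) (Fin 3) ℂ)ᴴ * H.map ι * (T : Matrix (Fin 3) (Fin 3) ℂ) = Literature.Geometry.ComplexHyperbolic.BallModel.J)
    (νinf : @Measure (UnitaryGroup.arch (↥(maximalRealSubfield L)) L (IsCMField.complexConj L) 3 H) (borel _)) :
    ArchCharactersLinIndep L ι H T hT νinf := by
  have hRC := archRealCase_of_package hTC hGE hIR hα hβ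
  rw [archCharactersLinIndep_iff]
  intro hdef hν a hsupp hsum hzero y
  -- real and imaginary parts (★ A8), as in the Lines composition `archCharactersLinIndep_of_stubs`
  obtain ⟨⟨hsre, hzre⟩, hsim, hzim⟩ := archRealReduction L ι H T hT νinf hν a hsum hzero
  have hre : (a y).re = 0 :=
    hRC L ι H T hT νinf hdef hν (fun y => (a y).re)
      (fun y hy => hsupp y fun h => hy (by rw [h, Complex.zero_re])) hsre hzre y
  have him : (a y).im = 0 :=
    hRC L ι H T hT νinf hdef hν (fun y => (a y).im)
      (fun y hy => hsupp y fun h => hy (by rw [h, Complex.zero_im])) hsim hzim y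
  exact Complex.ext hre him

/-- **The ∀-closed form** (the shape of the Lines head `ArchCharactersLinIndepClosed` = `∀ L … νinf, ArchCharactersLinIndep L ι H T hT νinf`), from the same five
hypotheses. [cite: Rogawski1990, Prop. 13.8.1 p. 212] [cite: LabesseLanglands1979, Lemma 6.1 pp. 768–769] -/
theorem archCharactersLinIndep_closed_of_letters
    (hα : ∀ r : GKIrrep (uFormGroup (Fin 2) (Fin 1)), IsAdmissibleGK r.ρK → r.IsInfUnitaryAlongP → Liu2021.LemD2.IsInfUnitary r.ρK r.ρ𝔤)
    (hβ : ∀ (L : Type) [Field L] [NumberField L] [IsCMField L] (ι : L →+* ℂ) (H : Matrix (Fin 3) (Fin 3) L) (T : GL (Fin 3) ℂ)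
      (hT : (T : Matrix (Fin 3) (Fin 3) ℂ)ᴴ * H.map ι * (T : Matrix (Fin 3) (Fin 3) ℂ) = Literature.Geometry.ComplexHyperbolic.BallModel.J)
      (νinf : @Measure (UnitaryGroup.arch (↥(maximalRealSubfield L)) L (IsCMField.complexConj L) 3 H) (borel _)),
      letI : MeasurableSpace (UnitaryGroup.arch (↥(maximalRealSubfield L)) L (IsCMField.complexConj L) 3 H) := borel _
      haveI : BorelSpace (UnitaryGroup.arch (↥(maximalRealSubfield L)) L (IsCMField.complexConj L) 3 H) := ⟨rfl⟩
      (∀ τ' : L →+* ℂ, InfinitePlace.mk τ' ≠ InfinitePlace.mk ι → (H.map τ').PosDef) →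
      ∀ (_hν : νinf.IsHaarMeasure),
        -- (a) `*`-algebra
        (∀ φ : UnitaryGroup.arch (↥(maximalRealSubfield L)) L (IsCMField.complexConj L) 3 H → ℂ, ArchTestKc L ι H T hT φ →
            ArchTestKc L ι H T hT (mulStar φ) ∧
            ∀ ψ : UnitaryGroup.arch (↥(maximalRealSubfield L)) L (IsCMField.complexConj L) 3 H → ℂ, ArchTestKc L ι H T hT ψ →
              ArchTestKc L ι H T hT (mulConv νinf φ ψ)) ∧
        -- (b) bi-`K_c`-average with the same operator on `K_c`-trivial representations
        (∀ ψ : UnitaryGroup.arch (↥(maximalRealSubfield L)) L (IsCMField.complexConj L) 3 H → ℂ, ∀ (hψc : Continuous ψ) (hψs : HasCompactSupport ψ),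
            (∃ ψ' : GL (Fin 3) (NumberField.mixedEmbedding.mixedSpace L) → ℂ, Continuous ψ' ∧ HasCompactSupport ψ' ∧
                IsArchSmooth (archGroupGL 3 L).carrier.subtype ψ' ∧
                ∀ k : UnitaryGroup.arch (↥(maximalRealSubfield L)) L (IsCMField.complexConj L) 3 H,
                  ψ k = ψ' (k : GL (Fin 3) (NumberField.mixedEmbedding.mixedSpace L))) →
            ∃ (ψn : UnitaryGroup.arch (↥(maximalRealSubfield L)) L (IsCMField.complexConj L) 3 H → ℂ) (hψn : ArchTestKc L ι H T hT ψn),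
              ∀ (x : GKIrrClass (uFormGroup (Fin 2) (Fin 1)))
                (E : Type) [NormedAddCommGroup E] [InnerProductSpace ℂ E] [CompleteSpace E]
                (ϖ : ContRepresentation ℂ (uFormGroup (Fin 2) (Fin 1)).carrier E) (hϖ : IsUnitaryGlobalization (uFormGroup (Fin 2) (Fin 1)) x ϖ),
                (ϖ.restrict (archProjUForm L ι H T hT)).integratedOperator (hϖ.isUnitary.restrict _)
                    (hϖ.isStronglyContinuous.restrict _ (continuous_archProjUForm L ι H T hT)) νinf ⟨⟨ψn, hψn.continuous⟩, hψn.hasCompactSupport⟩ =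
                  (ϖ.restrict (archProjUForm L ι H T hT)).integratedOperator (hϖ.isUnitary.restrict _)
                    (hϖ.isStronglyContinuous.restrict _ (continuous_archProjUForm L ι H T hT)) νinf ⟨⟨ψ, hψc⟩, hψs⟩) ∧
        -- (c) Dirac sequence in `ArchTestKc` for the `K_c`-trivial unitary globalizations
        (∃ (φn : ℕ → UnitaryGroup.arch (↥(maximalRealSubfield L)) L (IsCMField.complexConj L) 3 H → ℂ) (hφn : ∀ n, ArchTestKc L ι H T hT (φn n)),
            ∀ (x : GKIrrClass (uFormGroup (Fin 2) (Fin 1)))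
              (E : Type) [NormedAddCommGroup E] [InnerProductSpace ℂ E] [CompleteSpace E]
              (ϖ : ContRepresentation ℂ (uFormGroup (Fin 2) (Fin 1)).carrier E) (hϖ : IsUnitaryGlobalization (uFormGroup (Fin 2) (Fin 1)) x ϖ) (v : E),
              Tendsto (fun n => (ϖ.restrict (archProjUForm L ι H T hT)).integratedOperator (hϖ.isUnitary.restrict _)
                  (hϖ.isStronglyContinuous.restrict _ (continuous_archProjUForm L ι H T hT)) νinf
                  ⟨⟨φn n, (hφn n).continuous⟩, (hφn n).hasCompactSupport⟩ v) atTop (𝓝 v)))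
    (hTC : ∀ (L : Type) [Field L] [NumberField L] [IsCMField L] (ι : L →+* ℂ) (H : Matrix (Fin 3) (Fin 3) L) (T : GL (Fin 3) ℂ)
      (hT : (T : Matrix (Fin 3) (Fin 3) ℂ)ᴴ * H.map ι * (T : Matrix (Fin 3) (Fin 3) ℂ) = Literature.Geometry.ComplexHyperbolic.BallModel.J)
      (νinf : @Measure (UnitaryGroup.arch (↥(maximalRealSubfield L)) L (IsCMField.complexConj L) 3 H) (borel _)),
      ArchIntegratedOperatorTraceClass L ι H T hT νinf)
    (hGE : HasUnitaryGlobalizationOfInfUnitary) (hIR : UnitaryGlobalizationIrreducible) :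
    ∀ (L : Type) [Field L] [NumberField L] [IsCMField L] (ι : L →+* ℂ) (H : Matrix (Fin 3) (Fin 3) L) (T : GL (Fin 3) ℂ)
      (hT : (T : Matrix (Fin 3) (Fin 3) ℂ)ᴴ * H.map ι * (T : Matrix (Fin 3) (Fin 3) ℂ) = Literature.Geometry.ComplexHyperbolic.BallModel.J)
      (νinf : @Measure (UnitaryGroup.arch (↥(maximalRealSubfield L)) L (IsCMField.complexConj L) 3 H) (borel _)),
      ArchCharactersLinIndep L ι H T hT νinf :=
  fun L _ _ _ ι H T hT νinf => archCharactersLinIndep_of_letters hα hβ hTC hGE hIR L ι H T hT νinf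

end Literature.NumberTheory.Rogawski1990

end
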